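import Summits.BirchSwinnertonDyer.BirchSwinnertonDyer.Theorems.ClassRecordThreeRegCertKernel
import Summits.BirchSwinnertonDyer.BirchSwinnertonDyer.Theorems.ClassRecordThreeRegCertKernelO2Height
import Summits.BirchSwinnertonDyer.BirchSwinnertonDyer.Theorems.ClassRecordThreeRegCertKernelO3Mid
import Summits.BirchSwinnertonDyer.BirchSwinnertonDyer.Theorems.ClassRecordThreeRegCertKernelO4Log
import HarnessLib

/-!
# Route `ClassRecordThree`, crux `SchneiderAtThree` (item 19106): the FOURTH-DIGIT kernel evaluator and checker at a
# certificate point of depth EXACTLY `2` (`v₃(e(Q)) = 2`, `v₃(h(Q)) ≤ 4`) — `h mod 243` from `(a, b, e', a₁, a₂, γ)` and `u`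
# (cell `bsd-stepL`, seat `bsd-stepL-reg3-eng` g3; `--supports stmt-BirchSwinnertonDyer-19106`)

HONEST FRAMING: BSD is not proved by any of this; nothing here closes the crux; Schneider's conjecture (barrier
`PAdicHeightNondegeneracy`) is asserted NOWHERE; every application is ONE curve. One digit beyond `…O3Mid`: at depth
`2` the SAME main term `C²σ² ≡ L₀² + z⁴/(12γ) = 81·U` (`U = (γ(ae')²M² + 27(ae')⁴b²)/(4γb⁶)`,
`M = 2b² − 9a₁(ae')b + 54(a₁² + a₂)(ae')²`) already holds to precision `3⁻⁹` — every correction of `…O3Mid` §2 is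
`≤ 3⁻⁹` (the sigma product `‖Π − 1‖ ≤ ‖q‖‖ch w − 1‖ ≤ 3⁻⁵`, the cubic tail of `log_Ŵ` is `≤ ‖z‖⁴ = 3⁻⁸`, `‖C² − γ‖ ≤ 3⁻²`
enters at `3·3⁻⁸·3⁻²`), so only the residue (`243 ∣ γ(ae')²M² + 27(ae')⁴b² − 4γub⁶`) and the Iwasawa logarithms (four
terms, `…O4Log`) move: `h ≡ ½[(E − E²/2 + E³/3 − E⁴/4) − (V − V²/2 + V³/3 − V⁴/4)] (mod 243)`, `E = e'⁴ − 1`,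
`V = u² − 1`; CERTIFICATE **`3⁶ ∤ 12E − 6E² + 4E³ − 3E⁴ − 12V + 6V² − 4V³ + 3V⁴`** (§1
`heightFourOneCoord_ne_zero_of_midCertO4`, §2 the bundled checker `certNonsplit_of_midCertO4`). Validated offline on all
169 depth-2 rows of kit j249075 (`h mod 243` reproduced). Theorems only (0 defs, 0 facts).
References: [SteinWuthrich2013] §4.2; [SilvermanAEC2009] IV.6; [Iwasawa1972PadicL] §4.4.
-/

open scoped Classical
open PowerSeries WeierstrassCurve Literature.NumberTheory.EllipticCurves
  Literature.NumberTheory.EllipticCurves.Rank1Residual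
  Literature.NumberTheory.EllipticCurves.SteinWuthrich2013
  Summit.BirchSwinnertonDyer.Rank1Residual
  Summit.BirchSwinnertonDyer.Rank1Residual.X11b
  Summit.BirchSwinnertonDyer.Rank1Residual.X11b.RegMult.Rung62310y1

namespace Summit.BirchSwinnertonDyer.Rank1Residual.X11b.RegMult.KernelCert

/-! ### §0 Plumbing -/

/-- Ultrametric inequality for differences. [folklore] -/
private theorem norm_sub_le_max₁₃ (a b : ℚ_[3]) : ‖a - b‖ ≤ max ‖a‖ ‖b‖ := by
  rw [sub_eq_add_neg, ← norm_neg b]; exact IsUltrametricDist.norm_add_le_max a (-b)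

/-- `‖(2 : ℚ₃)⁻¹‖ = 1`. [folklore] -/
private theorem norm_inv_two₁₃ : ‖(2 : ℚ_[3])⁻¹‖ = 1 := by
  rw [norm_inv, show (2 : ℚ_[3]) = ((2 : ℤ) : ℚ_[3]) by norm_cast, norm_intCast_eq_one_of_not_dvd (by decide),
    inv_one]

/-- `‖(3 : ℚ₃)⁻¹‖ = 3`. [folklore] -/
private theorem norm_inv_three₁₃ : ‖(3 : ℚ_[3])⁻¹‖ = 3 := by
  rw [norm_inv, show (3 : ℚ_[3]) = ((3 : ℕ) : ℚ_[3]) by norm_cast, Padic.norm_p]; norm_num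

/-- `‖(12 : ℚ₃)⁻¹‖ = 3`. [folklore] -/
private theorem norm_inv_twelve₁₃ : ‖(12 : ℚ_[3])⁻¹‖ = 3 := by
  rw [show (12 : ℚ_[3]) = 4 * 3 by norm_num, mul_inv, norm_mul, norm_inv_three₁₃, norm_inv,
    show (4 : ℚ_[3]) = ((4 : ℤ) : ℚ_[3]) by norm_cast, norm_intCast_eq_one_of_not_dvd (by decide)]; norm_num

/-! ### §1 Assembly at depth exactly `2`, fourth digit -/

/-- **The fourth-digit DEPTH-TWO REG3CERT kernel certificate (`v₃(e(Q)) = 2`, `v₃(h(Q)) ≤ 4`).** `W/ℚ` globally minimal,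
`a₁, a₂, c₄, c₆` read in `ℚ₃`, `3 ∤ c₆`, `9 ∣ c₄ + γc₆`, `3 ∤ γ`; `(x, y) = (a/e², b/e³)`, `e = 9e'`, `3 ∤ e'`, `3 ∤ b`,
`gcd(a, e) = 1`; an integer `u` with `243 ∣ γ(ae')²M² + 27(ae')⁴b² − 4γub⁶`, `M = 2b² − 9a₁(ae')b + 54(a₁² + a₂)(ae')²`,
`3 ∤ u`, `3 ∣ u² − 1`. If **`3⁶ ∤ 12E − 6E² + 4E³ − 3E⁴ − 12V + 6V² − 4V³ + 3V⁴`** (`E = e'⁴ − 1`, `V = u² − 1`), then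
`heightFourOneCoord W 3 q x y ≠ 0` for EVERY `‖q‖₃ < 1`: `C²σ² ≡ L₀² + z⁴/(12γ) = 81·U` to precision `3⁻⁹`, and the two
Iwasawa logarithms to four terms. [cite: SteinWuthrich2013, §4.2] [cite: Iwasawa1972PadicL, §4.4] -/
theorem heightFourOneCoord_ne_zero_of_midCertO4 (W : WeierstrassCurve ℚ) [W.IsGloballyMinimal]
    {a₁ a₂ c4 c6 γ : ℤ} (ha1 : (W.baseChange ℚ_[3]).a₁ = a₁) (ha2 : (W.baseChange ℚ_[3]).a₂ = a₂)
    (hc4 : (W.baseChange ℚ_[3]).c₄ = c4) (hc6 : (W.baseChange ℚ_[3]).c₆ = c6) (h3c6 : ¬ (3 : ℤ) ∣ c6)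
    (hγ : (9 : ℤ) ∣ c4 + γ * c6) (h3γ : ¬ (3 : ℤ) ∣ γ)
    {a b : ℤ} {e' : ℕ} (h3e' : ¬ (3 : ℤ) ∣ e') (h3b : ¬ (3 : ℤ) ∣ b) (hcop : Nat.Coprime a.natAbs (3 ^ 2 * e'))
    {x y : ℚ} (hx : x = a / ((3 ^ 2 * e' : ℕ) : ℚ) ^ 2) (hy : y = b / ((3 ^ 2 * e' : ℕ) : ℚ) ^ 3)
    {u : ℤ} (hu : (243 : ℤ) ∣ γ * (a * e') ^ 2 * (2 * b ^ 2 - 9 * a₁ * (a * e') * b + 54 * (a₁ ^ 2 + a₂) * (a * e') ^ 2) ^ 2 +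
      27 * (a * e') ^ 4 * b ^ 2 - 4 * γ * u * b ^ 6) (h3u : ¬ (3 : ℤ) ∣ u) (h3u2 : (3 : ℤ) ∣ u ^ 2 - 1)
    (hcert : ¬ (729 : ℤ) ∣ 12 * ((e' : ℤ) ^ 4 - 1) - 6 * ((e' : ℤ) ^ 4 - 1) ^ 2 + 4 * ((e' : ℤ) ^ 4 - 1) ^ 3 -
      3 * ((e' : ℤ) ^ 4 - 1) ^ 4 - 12 * (u ^ 2 - 1) + 6 * (u ^ 2 - 1) ^ 2 - 4 * (u ^ 2 - 1) ^ 3 + 3 * (u ^ 2 - 1) ^ 4)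
    {q : ℚ_[3]} (hq : ‖q‖ < 1) :
    heightFourOneCoord W 3 q x y ≠ 0 := by
  have hq3 : ‖q‖ ≤ 1 / 3 := norm_le_third_of_norm_lt_one hq
  have he'0 : e' ≠ 0 := by rintro rfl; exact h3e' (by simp)
  have he0 : (3 ^ 2 * e' : ℕ) ≠ 0 := by positivity
  have hb0 : b ≠ 0 := by rintro rfl; exact h3b (dvd_zero 3)
  have hγ0 : γ ≠ 0 := by rintro rfl; exact h3γ (dvd_zero 3)
  have h3a : ¬ (3 : ℤ) ∣ a := by
    intro h
    have h1 : 3 ∣ a.natAbs := Int.natCast_dvd.mp h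
    have h3 : 3 ∣ Nat.gcd a.natAbs (3 ^ 2 * e') := Nat.dvd_gcd h1 (dvd_mul_of_dvd_left (dvd_pow_self 3 (by omega)) e')
    rw [hcop] at h3; omega
  have han : ‖(a : ℚ_[3])‖ = 1 := norm_intCast_eq_one_of_not_dvd h3a
  have hbn : ‖(b : ℚ_[3])‖ = 1 := norm_intCast_eq_one_of_not_dvd h3b
  have he'n : ‖(e' : ℚ_[3])‖ = 1 := by
    have := norm_intCast_eq_one_of_not_dvd h3e'; push_cast at this; exact this
  have hγn : ‖(γ : ℚ_[3])‖ = 1 := norm_intCast_eq_one_of_not_dvd h3γ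
  have ha1n : ‖(a₁ : ℚ_[3])‖ ≤ 1 := Padic.norm_int_le_one _
  have ha2n : ‖((a₁ : ℚ_[3]) ^ 2 + a₂)‖ ≤ 1 := by
    rw [show (a₁ : ℚ_[3]) ^ 2 + a₂ = (((a₁ ^ 2 + a₂ : ℤ)) : ℚ_[3]) by push_cast; ring]; exact Padic.norm_int_le_one _
  have hb0' : (b : ℚ_[3]) ≠ 0 := by exact_mod_cast hb0
  have hγ0' : (γ : ℚ_[3]) ≠ 0 := by exact_mod_cast hγ0
  have h2n : ‖(2 : ℚ_[3])‖ = 1 := by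
    rw [show (2 : ℚ_[3]) = ((2 : ℤ) : ℚ_[3]) by norm_cast]; exact norm_intCast_eq_one_of_not_dvd (by decide)
  set P : ℚ_[3] := (3 : ℚ_[3]) ^ (2 * 2) with hP
  have hPn : ‖P‖ = 1 / 81 := by
    rw [hP, norm_pow, show (3 : ℚ_[3]) = ((3 : ℕ) : ℚ_[3]) by norm_cast, Padic.norm_p]; norm_num
  set z : ℚ_[3] := -((a : ℚ_[3]) * ((3 ^ 2 * e' : ℕ) : ℚ_[3])) / (b : ℚ_[3]) with hz
  have hρ : ‖z‖ = 1 / 9 := by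
    rw [hz, norm_div, norm_neg, norm_mul, han, hbn, one_mul, div_one]
    push_cast
    rw [norm_mul, he'n, mul_one, show (9 : ℚ_[3]) = ((3 : ℕ) : ℚ_[3]) ^ 2 by norm_num, norm_pow, Padic.norm_p]
    norm_num
  have hz9 : ‖z‖ ≤ 1 / 9 := hρ.le
  -- §1: `L ≡ L₀ := z + a₁z²/2 + (a₁² + a₂)z³/3 (mod ‖z‖⁴ = 3⁻⁸)`
  set V := W.baseChange ℚ_[3] with hV
  set L := V.padicFormalLog z with hLdef
  set L0 := z + (2 : ℚ_[3])⁻¹ * a₁ * z ^ 2 + (3 : ℚ_[3])⁻¹ * ((a₁ : ℚ_[3]) ^ 2 + a₂) * z ^ 3 with hL0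
  have hLM : ‖L - L0‖ ≤ 1 / 6561 := by
    have h := norm_padicFormalLog_sub_cubic_le_deep V hz9; rw [ha1, ha2, hρ] at h; exact h.trans (by norm_num)
  have hL0z : ‖L0 - z‖ ≤ 1 / 81 := by
    rw [show L0 - z = (2 : ℚ_[3])⁻¹ * a₁ * z ^ 2 + (3 : ℚ_[3])⁻¹ * ((a₁ : ℚ_[3]) ^ 2 + a₂) * z ^ 3 by rw [hL0]; ring]
    refine (IsUltrametricDist.norm_add_le_max _ _).trans (max_le ?_ ?_)
    · rw [norm_mul, norm_mul, norm_inv_two₁₃, one_mul, norm_pow, hρ]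
      calc ‖(a₁ : ℚ_[3])‖ * (1 / 9) ^ 2 ≤ 1 * (1 / 9) ^ 2 := by gcongr
        _ = 1 / 81 := by norm_num
    · rw [norm_mul, norm_mul, norm_inv_three₁₃, norm_pow, hρ]
      calc 3 * ‖((a₁ : ℚ_[3]) ^ 2 + a₂)‖ * (1 / 9) ^ 3 ≤ 3 * 1 * (1 / 9) ^ 3 := by gcongr
        _ ≤ 1 / 81 := by norm_num
  have hLz : ‖L - z‖ ≤ 1 / 81 := by
    rw [show L - z = (L - L0) + (L0 - z) by ring]
    exact (IsUltrametricDist.norm_add_le_max _ _).trans (max_le (hLM.trans (by norm_num)) hL0z)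
  have hLn : ‖L‖ = 1 / 9 := by
    rw [← hρ]; refine Padic.norm_eq_of_norm_sub_lt_right (hLz.trans_lt ?_); rw [hρ]; norm_num
  have hL0n : ‖L0‖ = 1 / 9 := by
    rw [← hρ]; refine Padic.norm_eq_of_norm_sub_lt_right (hL0z.trans_lt ?_); rw [hρ]; norm_num
  -- `C² ≡ γ (mod 9)`, `w`, `ch w − 1`, the sigma product
  have hC := norm_uniformisationScaleSq_sub_le W hc4 hc6 h3c6 hγ hq3
  set C2 := uniformisationScaleSq W 3 q with hC2
  have hCn : ‖C2‖ = 1 := by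
    rw [← hγn]; exact Padic.norm_eq_of_norm_sub_lt_right (hC.trans_lt (by rw [hγn]; norm_num))
  have hC0 : C2 ≠ 0 := by intro h; rw [h, norm_zero] at hCn; exact zero_ne_one hCn
  have hwdef : logUnitParamSq W 3 q x y = L ^ 2 / C2 := by rw [logUnitParamSq, hx, hy, neg_div_cast_eq hb0 he0]
  set w := L ^ 2 / C2 with hw
  have hwn : ‖w‖ = 1 / 81 := by rw [hw, norm_div, norm_pow, hLn, hCn]; norm_num
  have hw9 : ‖w‖ ≤ 1 / 9 := by rw [hwn]; norm_num
  have hw81 : ‖w‖ ≤ 1 / 81 := hwn.le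
  have hCw : C2 * w = L ^ 2 := by rw [hw]; field_simp
  set c := coshOfSq w with hc
  have hcR : ‖c - (1 + w / 2 + w ^ 2 / 24 + w ^ 3 / 720)‖ ≤ 9 * ‖w‖ ^ 4 := by
    have := norm_coshOfSq_sub_cubic_le hw9; rwa [hc]
  have hc1 : ‖(c - 1) - w / 2‖ ≤ 3 * ‖w‖ ^ 2 := by have := norm_coshOfSq_sub_one_sub_half_le hw81; rwa [hc]
  have hw2 : ‖w / 2‖ = 1 / 81 := by rw [norm_div, h2n, div_one, hwn]
  have hc1n : ‖c - 1‖ = 1 / 81 := by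
    rw [← hw2]; refine Padic.norm_eq_of_norm_sub_lt_right (hc1.trans_lt ?_); rw [hw2, hwn]; norm_num
  have hcn : ‖c‖ ≤ 1 := by
    rw [show c = (c - 1) + 1 by ring]
    refine (IsUltrametricDist.norm_add_le_max _ _).trans (max_le ?_ (by rw [norm_one])); rw [hc1n]; norm_num
  have hPr := norm_tprod_tateSigmaSq_factor_sub_one_le hq hcn
  set Pr := ∏' n : ℕ, (1 - 2 * q ^ (n + 1) * c + q ^ (2 * (n + 1))) ^ 2 / (1 - q ^ (n + 1)) ^ 4 with hPrdef
  have hσ : tateSigmaSq q c = 2 * (c - 1) * Pr := by rw [tateSigmaSq]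
  -- `U = (γ(ae')²M² + 27(ae')⁴b²)/(4γb⁶)`, `81·U = L₀² + z⁴/(12γ)`
  set Dn : ℤ := 4 * γ * b ^ 6 with hDn
  set Nn : ℤ := γ * (a * e') ^ 2 * (2 * b ^ 2 - 9 * a₁ * (a * e') * b + 54 * (a₁ ^ 2 + a₂) * (a * e') ^ 2) ^ 2 +
    27 * (a * e') ^ 4 * b ^ 2 with hNn
  have hDnn : ‖(Dn : ℚ_[3])‖ = 1 := by
    rw [hDn]; push_cast
    rw [norm_mul, norm_mul, norm_pow, hγn, hbn, show (4 : ℚ_[3]) = ((4 : ℤ) : ℚ_[3]) by norm_cast,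
      norm_intCast_eq_one_of_not_dvd (by decide)]; norm_num
  have hDn0 : (Dn : ℚ_[3]) ≠ 0 := by intro h; rw [h, norm_zero] at hDnn; exact zero_ne_one hDnn
  set U : ℚ_[3] := (Nn : ℚ_[3]) / (Dn : ℚ_[3]) with hU
  have hPU : L0 ^ 2 + (12 : ℚ_[3])⁻¹ * ((γ : ℚ_[3]))⁻¹ * z ^ 4 = P * U := by
    have h12 : (2 : ℚ_[3]) ≠ 0 ∧ (3 : ℚ_[3]) ≠ 0 ∧ (12 : ℚ_[3]) ≠ 0 := by norm_num
    rw [hU, hNn, hDn, hL0, hz, hP]; push_cast; field_simp; ring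
  have hun : ‖(u : ℚ_[3])‖ = 1 := norm_intCast_eq_one_of_not_dvd h3u
  have hUu : ‖U - u‖ ≤ 1 / 243 := by
    have hid : U - u = ((((γ * (a * e') ^ 2 * (2 * b ^ 2 - 9 * a₁ * (a * e') * b + 54 * (a₁ ^ 2 + a₂) * (a * e') ^ 2) ^ 2 +
        27 * (a * e') ^ 4 * b ^ 2 - 4 * γ * u * b ^ 6 : ℤ)) : ℚ_[3])) / (Dn : ℚ_[3]) := by
      rw [hU, eq_div_iff hDn0, sub_mul, div_mul_cancel₀ _ hDn0, hNn, hDn]; push_cast; ring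
    rw [hid, norm_div, hDnn, div_one]
    exact (norm_intCast_le_of_pow_dvd (k := 5) (by norm_num; exact hu)).trans (by norm_num)
  have hUn : ‖U‖ = 1 := by
    rw [← hun]; exact Padic.norm_eq_of_norm_sub_lt_right (hUu.trans_lt (by rw [hun]; norm_num))
  have hU2 : ‖U ^ 2 - 1‖ ≤ 1 / 3 := by
    rw [show U ^ 2 - 1 = (U - u) * (U + u) + (((u ^ 2 - 1 : ℤ)) : ℚ_[3]) by push_cast; ring]
    refine (IsUltrametricDist.norm_add_le_max _ _).trans (max_le ?_ ?_)
    · rw [norm_mul]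
      have hUu' : ‖U + u‖ ≤ 1 := (IsUltrametricDist.norm_add_le_max _ _).trans (max_le hUn.le hun.le)
      calc ‖U - u‖ * ‖U + u‖ ≤ 1 / 243 * 1 := by gcongr
        _ ≤ 1 / 3 := by norm_num
    · exact (norm_intCast_le_of_pow_dvd (k := 1) (by rw [pow_one]; exact h3u2)).trans (by norm_num)
  -- `Y = C²σ² ≡ 81·U (mod 3⁻⁹)`
  have hY : ‖C2 * tateSigmaSq q c - P * U‖ ≤ ‖P‖ / 243 := by
    rw [hσ, ← hPU, hPn]
    have hsplit : C2 * (2 * (c - 1) * Pr) - (L0 ^ 2 + (12 : ℚ_[3])⁻¹ * ((γ : ℚ_[3]))⁻¹ * z ^ 4) =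
        (C2 * w - L ^ 2) * (1 + (C2 * w + L ^ 2) / (12 * C2)) +
        2 * C2 * (c - 1) * (Pr - 1) + 2 * C2 * (c - (1 + w / 2 + w ^ 2 / 24 + w ^ 3 / 720)) +
        C2 * w ^ 3 / 360 + (L - L0) * (L + L0) +
        (12 : ℚ_[3])⁻¹ * ((L ^ 2 - z ^ 2) * (L ^ 2 + z ^ 2) / C2 + z ^ 4 * ((γ : ℚ_[3]) - C2) / (C2 * γ)) := by
      have h12 : (12 : ℚ_[3]) ≠ 0 := by norm_num
      field_simp; ring
    rw [hsplit, hCw, sub_self, zero_mul, zero_add]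
    have hb1 : ‖2 * C2 * (c - 1) * (Pr - 1)‖ ≤ 1 / 81 / 243 := by
      rw [norm_mul, norm_mul, norm_mul, h2n, hCn, hc1n, one_mul, one_mul]
      calc 1 / 81 * ‖Pr - 1‖ ≤ 1 / 81 * (‖q‖ * ‖c - 1‖) := by gcongr
        _ ≤ 1 / 81 * (1 / 3 * (1 / 81)) := by rw [hc1n]; gcongr
        _ ≤ 1 / 81 / 243 := by norm_num
    have hb2 : ‖2 * C2 * (c - (1 + w / 2 + w ^ 2 / 24 + w ^ 3 / 720))‖ ≤ 1 / 81 / 243 := by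
      rw [norm_mul, norm_mul, h2n, hCn, one_mul, one_mul]; refine hcR.trans ?_; rw [hwn]; norm_num
    have hb3 : ‖C2 * w ^ 3 / 360‖ ≤ 1 / 81 / 243 := by
      have h360 : ‖(360 : ℚ_[3])‖ = 1 / 9 := by
        rw [show (360 : ℚ_[3]) = ((40 : ℤ) : ℚ_[3]) * (((3 : ℕ) : ℚ_[3]) ^ 2) by push_cast; norm_num, norm_mul,
          norm_pow, norm_intCast_eq_one_of_not_dvd (by decide), Padic.norm_p]; norm_num
      rw [norm_div, norm_mul, norm_pow, hCn, hwn, h360]; norm_num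
    have hb4 : ‖(L - L0) * (L + L0)‖ ≤ 1 / 81 / 243 := by
      rw [norm_mul]
      calc ‖L - L0‖ * ‖L + L0‖ ≤ 1 / 6561 * (1 / 9) := by
            gcongr; exact (IsUltrametricDist.norm_add_le_max _ _).trans (max_le hLn.le hL0n.le)
        _ ≤ 1 / 81 / 243 := by norm_num
    have hb5 : ‖(12 : ℚ_[3])⁻¹ * ((L ^ 2 - z ^ 2) * (L ^ 2 + z ^ 2) / C2 + z ^ 4 * ((γ : ℚ_[3]) - C2) / (C2 * γ))‖ ≤
        1 / 81 / 243 := by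
      rw [norm_mul, norm_inv_twelve₁₃]
      have h1 : ‖(L ^ 2 - z ^ 2) * (L ^ 2 + z ^ 2) / C2‖ ≤ 1 / 729 * (1 / 81) := by
        rw [norm_div, hCn, div_one, norm_mul, show L ^ 2 - z ^ 2 = (L - z) * (L + z) by ring, norm_mul]
        gcongr
        · calc ‖L - z‖ * ‖L + z‖ ≤ 1 / 81 * (1 / 9) := by
                gcongr; exact (IsUltrametricDist.norm_add_le_max _ _).trans (max_le hLn.le hρ.le)
            _ = 1 / 729 := by norm_num
        · refine (IsUltrametricDist.norm_add_le_max _ _).trans (max_le ?_ ?_) <;> rw [norm_pow]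
          · rw [hLn]; norm_num
          · rw [hρ]; norm_num
      have h2 : ‖z ^ 4 * ((γ : ℚ_[3]) - C2) / (C2 * γ)‖ ≤ (1 / 9) ^ 4 * (1 / 9) := by
        rw [norm_div, norm_mul, norm_mul, hCn, hγn, mul_one, div_one, norm_pow, hρ, ← norm_neg, neg_sub]; gcongr
      calc 3 * ‖(L ^ 2 - z ^ 2) * (L ^ 2 + z ^ 2) / C2 + z ^ 4 * ((γ : ℚ_[3]) - C2) / (C2 * γ)‖
          ≤ 3 * max (1 / 729 * (1 / 81)) ((1 / 9) ^ 4 * (1 / 9)) := by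
            gcongr; exact (IsUltrametricDist.norm_add_le_max _ _).trans (max_le_max h1 h2)
        _ ≤ 1 / 81 / 243 := by norm_num
    refine (IsUltrametricDist.norm_add_le_max _ _).trans (max_le ?_ hb5)
    refine (IsUltrametricDist.norm_add_le_max _ _).trans (max_le ?_ hb4)
    refine (IsUltrametricDist.norm_add_le_max _ _).trans (max_le ?_ hb3)
    exact (IsUltrametricDist.norm_add_le_max _ _).trans (max_le hb1 hb2)
  have hlogY := norm_padicLog_sub_le_deepO4 2 hUn hU2 hY
  -- the cubic polynomial at `U ≡ u (mod 81)`
  have hT0 : ‖1 - U ^ 2‖ ≤ 1 / 3 := by rw [← norm_neg, neg_sub]; exact hU2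
  have hT1 : ‖1 - (u : ℚ_[3]) ^ 2‖ ≤ 1 / 3 := by
    rw [show (1 : ℚ_[3]) - (u : ℚ_[3]) ^ 2 = -(((u ^ 2 - 1 : ℤ) : ℚ_[3])) by push_cast; ring, norm_neg]
    exact (norm_intCast_le_of_pow_dvd (k := 1) (by rw [pow_one]; exact h3u2)).trans (by norm_num)
  have hPoly : ‖((U ^ 2 - 1) - (U ^ 2 - 1) ^ 2 / 2 + (U ^ 2 - 1) ^ 3 / 3 - (U ^ 2 - 1) ^ 4 / 4) -
      (((u : ℚ_[3]) ^ 2 - 1) - ((u : ℚ_[3]) ^ 2 - 1) ^ 2 / 2 + ((u : ℚ_[3]) ^ 2 - 1) ^ 3 / 3 -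
        ((u : ℚ_[3]) ^ 2 - 1) ^ 4 / 4)‖ ≤ 1 / 243 := by
    have hid : ((U ^ 2 - 1) - (U ^ 2 - 1) ^ 2 / 2 + (U ^ 2 - 1) ^ 3 / 3 - (U ^ 2 - 1) ^ 4 / 4) -
        (((u : ℚ_[3]) ^ 2 - 1) - ((u : ℚ_[3]) ^ 2 - 1) ^ 2 / 2 + ((u : ℚ_[3]) ^ 2 - 1) ^ 3 / 3 -
          ((u : ℚ_[3]) ^ 2 - 1) ^ 4 / 4) =
        -(((1 - U ^ 2) + (1 - U ^ 2) ^ 2 / 2 + (1 - U ^ 2) ^ 3 / 3 + (1 - U ^ 2) ^ 4 / 4) -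
          ((1 - (u : ℚ_[3]) ^ 2) + (1 - (u : ℚ_[3]) ^ 2) ^ 2 / 2 + (1 - (u : ℚ_[3]) ^ 2) ^ 3 / 3 +
            (1 - (u : ℚ_[3]) ^ 2) ^ 4 / 4)) := by ring
    rw [hid, norm_neg]
    refine (norm_quarticPoly_sub_le hT0 hT1).trans ?_
    rw [show (1 - U ^ 2) - (1 - (u : ℚ_[3]) ^ 2) = -((U - u) * (U + u)) by ring, norm_neg, norm_mul]
    have hUu' : ‖U + u‖ ≤ 1 := (IsUltrametricDist.norm_add_le_max _ _).trans (max_le hUn.le hun.le)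
    calc ‖U - u‖ * ‖U + u‖ ≤ 1 / 243 * 1 := by gcongr
      _ = 1 / 243 := mul_one _
  -- `den x = 81e'²`
  have hden : x.den = (3 ^ 2 * e') ^ 2 := by
    have hpos : (0 : ℤ) < ((3 ^ 2 * e' : ℕ) : ℤ) ^ 2 := by positivity
    have hcop2 : Nat.Coprime a.natAbs ((((3 ^ 2 * e' : ℕ) : ℤ) ^ 2).natAbs) := by
      rw [Int.natAbs_pow, Int.natAbs_natCast]; exact hcop.pow_right 2
    have h := Rat.den_div_eq_of_coprime hpos hcop2
    have hx' : x = ((a : ℤ) : ℚ) / ((((3 ^ 2 * e' : ℕ) : ℤ) ^ 2 : ℤ) : ℚ) := by rw [hx]; push_cast; ring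
    rw [← hx'] at h
    exact_mod_cast h
  set Ud : ℚ_[3] := (e' : ℚ_[3]) ^ 2 with hUd
  have hUdn : ‖Ud‖ = 1 := by rw [hUd, norm_pow, he'n, one_pow]
  have hUd2 : ‖Ud ^ 2 - 1‖ ≤ 1 / 3 := by
    rw [show Ud ^ 2 - 1 = ((((e' : ℤ) ^ 4 - 1 : ℤ)) : ℚ_[3]) by rw [hUd]; push_cast; ring]
    exact (norm_intCast_le_of_pow_dvd (k := 1) (by rw [pow_one]; exact three_dvd_pow_four_sub_one h3e')).trans
      (by norm_num)
  have hYd : ‖(((x.den : ℚ)) : ℚ_[3]) - P * Ud‖ ≤ ‖P‖ / 243 := by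
    have : (((x.den : ℚ)) : ℚ_[3]) = P * Ud := by rw [hden, hP, hUd]; push_cast; ring
    rw [this, sub_self, norm_zero]; positivity
  have hlogd := norm_padicLog_sub_le_deepO4 2 hUdn hUd2 hYd
  intro h0
  rw [heightFourOneCoord, hwdef] at h0
  have heq : padicLog 3 (((x.den : ℚ)) : ℚ_[3]) = padicLog 3 (C2 * tateSigmaSq q c) := sub_eq_zero.mp h0
  rw [heq] at hlogd
  set PU := (U ^ 2 - 1) - (U ^ 2 - 1) ^ 2 / 2 + (U ^ 2 - 1) ^ 3 / 3 - (U ^ 2 - 1) ^ 4 / 4 with hPU'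
  set Pu := ((u : ℚ_[3]) ^ 2 - 1) - ((u : ℚ_[3]) ^ 2 - 1) ^ 2 / 2 + ((u : ℚ_[3]) ^ 2 - 1) ^ 3 / 3 -
    ((u : ℚ_[3]) ^ 2 - 1) ^ 4 / 4 with hPu
  set PE := (Ud ^ 2 - 1) - (Ud ^ 2 - 1) ^ 2 / 2 + (Ud ^ 2 - 1) ^ 3 / 3 - (Ud ^ 2 - 1) ^ 4 / 4 with hPE
  have hdiff : ‖(2 : ℚ_[3])⁻¹ * PE - (2 : ℚ_[3])⁻¹ * Pu‖ ≤ 1 / 243 := by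
    have : (2 : ℚ_[3])⁻¹ * PE - (2 : ℚ_[3])⁻¹ * Pu = ((padicLog 3 (C2 * tateSigmaSq q c) - (2 : ℚ_[3])⁻¹ * PU) -
        (padicLog 3 (C2 * tateSigmaSq q c) - (2 : ℚ_[3])⁻¹ * PE)) + (2 : ℚ_[3])⁻¹ * (PU - Pu) := by ring
    rw [this]
    refine (IsUltrametricDist.norm_add_le_max _ _).trans
      (max_le ((norm_sub_le_max₁₃ _ _).trans (max_le hlogY hlogd)) ?_)
    rw [norm_mul, norm_inv_two₁₃, one_mul]; exact hPoly
  have hid : (2 : ℚ_[3])⁻¹ * PE - (2 : ℚ_[3])⁻¹ * Pu = (24 : ℚ_[3])⁻¹ *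
      (((12 * ((e' : ℤ) ^ 4 - 1) - 6 * ((e' : ℤ) ^ 4 - 1) ^ 2 + 4 * ((e' : ℤ) ^ 4 - 1) ^ 3 -
        3 * ((e' : ℤ) ^ 4 - 1) ^ 4 - 12 * (u ^ 2 - 1) + 6 * (u ^ 2 - 1) ^ 2 - 4 * (u ^ 2 - 1) ^ 3 +
        3 * (u ^ 2 - 1) ^ 4 : ℤ)) : ℚ_[3]) := by
    have h24 : (2 : ℚ_[3]) ≠ 0 ∧ (3 : ℚ_[3]) ≠ 0 ∧ (4 : ℚ_[3]) ≠ 0 ∧ (24 : ℚ_[3]) ≠ 0 := by norm_num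
    rw [hPE, hPu, hUd]; push_cast; field_simp; ring
  have h24n : ‖(24 : ℚ_[3])⁻¹‖ = 3 := by
    rw [show (24 : ℚ_[3]) = 8 * 3 by norm_num, mul_inv, norm_mul, norm_inv_three₁₃, norm_inv,
      show (8 : ℚ_[3]) = ((8 : ℤ) : ℚ_[3]) by norm_cast, norm_intCast_eq_one_of_not_dvd (by decide)]; norm_num
  rw [hid, norm_mul, h24n] at hdiff
  have h729 : ((3 : ℕ) : ℤ) ^ 6 ∣ 12 * ((e' : ℤ) ^ 4 - 1) - 6 * ((e' : ℤ) ^ 4 - 1) ^ 2 + 4 * ((e' : ℤ) ^ 4 - 1) ^ 3 -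
      3 * ((e' : ℤ) ^ 4 - 1) ^ 4 - 12 * (u ^ 2 - 1) + 6 * (u ^ 2 - 1) ^ 2 - 4 * (u ^ 2 - 1) ^ 3 + 3 * (u ^ 2 - 1) ^ 4 :=
    (Padic.norm_int_le_pow_iff_dvd (p := 3) _ 6).mp (by
      have : ‖((((12 * ((e' : ℤ) ^ 4 - 1) - 6 * ((e' : ℤ) ^ 4 - 1) ^ 2 + 4 * ((e' : ℤ) ^ 4 - 1) ^ 3 -
          3 * ((e' : ℤ) ^ 4 - 1) ^ 4 - 12 * (u ^ 2 - 1) + 6 * (u ^ 2 - 1) ^ 2 - 4 * (u ^ 2 - 1) ^ 3 +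
          3 * (u ^ 2 - 1) ^ 4 : ℤ)) : ℚ_[3]))‖ ≤ 1 / 729 := by linarith only [hdiff]
      exact this.trans (by norm_num))
  exact hcert (by simpa using h729)

/-! ### §2 The bundled checker -/

/-- **`RegMult.CertNonsplit W 3 Q 1` from a FOURTH-DIGIT DEPTH-TWO REG3CERT certificate (`v₃(e(Q)) = 2`).** For the integer
model `W = ⟨a₁,…,a₆⟩` (globally minimal, elliptic) and `Q = (a/e², b/e³)`, `e = 9e'`, the hypothesis `H` bundles the
row's integer facts (`c₄`, `c₆`, `3 ∤ c₆`, `9 ∣ c₄ + γc₆`, `3 ∤ γ`, `3 ∤ e'`, `3 ∤ b`, `gcd(a, e) = 1`, the gcd reduction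
test, `243 ∣ γ(ae')²M² + 27(ae')⁴b² − 4γub⁶`, `3 ∤ u`, `3 ∣ u² − 1`,
**`3⁶ ∤ 12E − 6E² + 4E³ − 3E⁴ − 12V + 6V² − 4V³ + 3V⁴`**), decided per row by ONE `norm_num`; conclusion: admissibility of
`Q` at `3` and `heightFourOneCoord W 3 q x y ≠ 0` for every `‖q‖₃ < 1` (`heightFourOneCoord_ne_zero_of_midCertO4`).
Per curve; nothing class-wide. [cite: SteinWuthrich2013, §4.2] [cite: MazurSteinTate2006, §1] [cite: SilvermanAEC2009, VII.3.4] -/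
theorem certNonsplit_of_midCertO4 (W : WeierstrassCurve ℚ) {a₁ a₂ a₃ a₄ a₆ : ℤ} (hW : W = ⟨a₁, a₂, a₃, a₄, a₆⟩)
    [W.IsElliptic] [W.IsGloballyMinimal] {a b c4 c6 γ u : ℤ} {e' n : ℕ}
    (H : c4 = (a₁ ^ 2 + 4 * a₂) ^ 2 - 24 * (2 * a₄ + a₁ * a₃) ∧
      c6 = -(a₁ ^ 2 + 4 * a₂) ^ 3 + 36 * (a₁ ^ 2 + 4 * a₂) * (2 * a₄ + a₁ * a₃) - 216 * (a₃ ^ 2 + 4 * a₆) ∧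
      ¬ (3 : ℤ) ∣ c6 ∧ (9 : ℤ) ∣ c4 + γ * c6 ∧ ¬ (3 : ℤ) ∣ γ ∧ ¬ (3 : ℤ) ∣ e' ∧ ¬ (3 : ℤ) ∣ b ∧
      Nat.Coprime a.natAbs (3 ^ 2 * e') ∧
      Int.gcd (2 * b + a₁ * a * (3 ^ 2 * e' : ℕ) + a₃ * (3 ^ 2 * e' : ℕ) ^ 3)
        (a₁ * b * (3 ^ 2 * e' : ℕ) - (3 * a ^ 2 + 2 * a₂ * a * (3 ^ 2 * e' : ℕ) ^ 2 + a₄ * (3 ^ 2 * e' : ℕ) ^ 4)) ∣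
        (3 ^ 2 * e') ^ n ∧
      (243 : ℤ) ∣ γ * (a * e') ^ 2 * (2 * b ^ 2 - 9 * a₁ * (a * e') * b + 54 * (a₁ ^ 2 + a₂) * (a * e') ^ 2) ^ 2 +
        27 * (a * e') ^ 4 * b ^ 2 - 4 * γ * u * b ^ 6 ∧ ¬ (3 : ℤ) ∣ u ∧ (3 : ℤ) ∣ u ^ 2 - 1 ∧
      ¬ (729 : ℤ) ∣ 12 * ((e' : ℤ) ^ 4 - 1) - 6 * ((e' : ℤ) ^ 4 - 1) ^ 2 + 4 * ((e' : ℤ) ^ 4 - 1) ^ 3 -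
        3 * ((e' : ℤ) ^ 4 - 1) ^ 4 - 12 * (u ^ 2 - 1) + 6 * (u ^ 2 - 1) ^ 2 - 4 * (u ^ 2 - 1) ^ 3 + 3 * (u ^ 2 - 1) ^ 4)
    {x y : ℚ} (hx : x = a / ((3 ^ 2 * e' : ℕ) : ℚ) ^ 2) (hy : y = b / ((3 ^ 2 * e' : ℕ) : ℚ) ^ 3)
    (h : W.toAffine.Nonsingular x y) : RegMult.CertNonsplit W 3 (.some x y h) 1 := by
  obtain ⟨hc4, hc6, h3c6, hγ, h3γ, h3e', h3b, hcop, hgcd, hu, h3u, h3u2, hcert⟩ := H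
  have he'0 : e' ≠ 0 := by rintro rfl; exact h3e' (by simp)
  have he0 : (3 ^ 2 * e' : ℕ) ≠ 0 := by positivity
  have h3e : 3 ∣ 3 ^ 2 * e' := dvd_mul_of_dvd_left (dvd_pow_self 3 (by omega)) e'
  have hx1 : 1 < ‖(x : ℚ_[3])‖ := by
    haveI : Fact (Nat.Prime 3) := ⟨Nat.prime_three⟩
    exact (one_lt_norm_ratCast_iff 3 x).mpr (padicValRat_x_neg he0 hx hcop h3e)
  have hadm : W.IsAdmissible 3 (.some x y h) :=
    isAdmissible_of_one_lt_norm (by norm_num) h hx1 (hasNonsingularReductionAt_of_gcd W hW he0 hx hy hcop hgcd)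
  refine ⟨by rw [one_smul]; exact hadm, fun q _ hq1 _ => ?_⟩
  rw [one_smul]
  exact heightFourOneCoord_ne_zero_of_midCertO4 W (baseChange_a₁_eq W hW) (baseChange_a₂_eq W hW)
    (baseChange_c₄_eq W hW hc4) (baseChange_c₆_eq W hW hc6) h3c6 hγ h3γ h3e' h3b hcop hx hy hu h3u h3u2 hcert hq1

end Summit.BirchSwinnertonDyer.Rank1Residual.X11b.RegMult.KernelCert
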